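import Mathlib
import Literature.Analysis.FluidPDE.Tao2016AveragedNS.CascadeTableDictionary
import Literature.Analysis.FluidPDE.Tao2016AveragedNS.SelfSimilarCascadeBlowup
import Literature.Analysis.FluidPDE.Tao2016AveragedNS.ViscousDyadicMemberRegularity
import Summits.NavierStokesRegularity.NavierStokesRegularity.Theorems.TaoLadderRungTwoBreakTwinRotorTableDefs
import HarnessLib

/-!
# The twin-rotor embedding ON THE BLOW-UP SIDE of K2(1): every global pseudo-solution of the dyadic member
  embeds diagonally as a global pseudo-solution of the twin-rotor table `∈ E₂(1)` from the two-mode diagonal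
  datum, with the SAME defect budget — so a robust blow-up of the sharpest sub-dyadic two-mode member would be a
  robust blow-up of the Katz–Pavlović chain, and every non-blow-up theorem for the dyadic member
  (Barbato–Morandin–Romito at `ε₀ = 1`; the tree's certified ranges of `OrthantWake.DyadicBreakBelowOne`) kills it
  (`--supports stmt-NavierStokesRegularity-20206`)

MODEL lattice ODEs only (Tao 2016 §1.2, §4 Lemma 4.1 (4.5)–(4.11), Thm. 4.2 statement shape); nothing here is a
statement about the Navier–Stokes equations; NO item is closed.  DEF-FREE (the twin family, twin energies and twin
datum are the lambdas `fun i k t => if i = 0 ∨ i = 1 then X 0 k t / 2 else 0`, `… E 0 k t / 4 …`,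
`fun i => if i = 0 ∨ i = 1 then X₀ 0 / 2 else 0`; the table `twinRotorTable` and the direction `twinRotorDir` are
the landed objects of `…TwinRotorTableDefs`).  ROUTE-INDEPENDENT MODULE (no `Theses` import).

Context.  `…BlowupRigidityOneSquareFreeOneMode` / `…VoidEternal` (this hand) showed that below the dyadic spread
`R < 2` the crux K2(1) `TaoLadderRungTwoBreak.BlowupRigidityOne` and the rung leaf `Target` have content only on
data charging TWO modes of tables with a live CROSS outflow.  The sharpest such member is the twin-rotor table of
`…TwinRotorTableDefs` (cross feeds `x₀x₁ ↦` both twins, in `E₂(R)` for every `R ≥ 1`), which on the K1 side was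
shown to carry the dyadic chain diagonally (`…NoSurvivingEternalViscBddOneTwinRotorEmbedding`, eternal
solutions).  This file is the K2 / Target-side companion, at the level of Lemma 4.1's PSEUDO-solutions:

* `qform_twinRotor_diag_feed/back₁/back₂/intra`, `shellVec_twin`, `quadTerm_twin` — on the twin family
  `X^tw_{0,n} = X^tw_{1,n} = X_{0,n}/2`, `X^tw_{2,n} = X^tw_{3,n} = 0` the cascade nonlinearity of the twin-rotor table
  is HALF the dyadic one on the twins and `0` on the idle modes (`quadTerm_dyadicTable_zero`);
* `cascadeODESolutionFrom_twin_of_dyadic` — hence for every `ε₀ > −1` the map `(X, E) ↦ (X^tw, E^tw)`,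
  `E^tw_{twin,n} = E_{0,n}/4`, sends a global `(K₁,K₂)`-pseudo-solution of `dyadicTable` from `X₀` at shell `n₀` to a
  global `(K₁,K₂)`-pseudo-solution of `twinRotorTable` from the diagonal datum `(X₀ 0/2)(1,1,0,0)` at shell `n₀`
  (all of (4.5)–(4.11) scale: amplitudes by `1/2`, energies by `1/4`, `√E` by `1/2`);
* `hasGlobal_twin_of_dyadic`, `noGlobalCascade_dyadic_of_twin`, `not_noGlobalCascade_twin_of_dyadic` — so
  `HasGlobal` transfers, and a ROBUST BLOW-UP of the twin-rotor table from a diagonal two-mode datum would be a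
  robust blow-up of the dyadic member from the corresponding one-mode datum (same `ε₀`, same budgets);
* `not_noGlobalCascade_twin_one` — at `ε₀ = 1` (shell ratio `2`) the twin-rotor table does NOT blow up robustly
  from any diagonal datum `(a/2)(1,1,0,0)`, `a ≥ 0`: Barbato–Morandin–Romito's Theorem 1 for the dyadic member
  (tree `not_noGlobalCascade_one_dyadicTable`) transported;
* `not_noGlobalCascade_twin_of_dyadicBreak` — BY SHAPE: the statement of item ⟨24644⟩
  `OrthantWake.DyadicBreakBelowOne` (`∀ ε₀ ∈ (0,1) ∀ X₀, ¬ NoGlobalCascade ε₀ dyadicTable X₀`; certified in the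
  tree on `[9/16, 1]`, `not_noGlobalCascade_dyadicTable_of_ge_nine_sixteenths`, not imported here to stay out of
  two route cones) gives the same at every `ε₀ ∈ (0,1)`.

READING for the census of ⟨20206⟩/⟨20204⟩: on the blow-up side the sub-dyadic two-mode corner CONTAINS the dyadic
member's non-blow-up question (remaining lemma (D), BMR at every base) through the twin rotor — in the direction
«dyadic regular ⇒ twin diagonal regular»; the converse transfer is NOT claimed (a pseudo-solution of the twin table
from a diagonal datum need not stay diagonal).  HONEST LABEL: dictionary work; no stub, crux, rung or summit is
proved; rung 0.
-/

noncomputable section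

-- the summit and its single sub-problem share the name (CONVENTIONS §1)
set_option linter.dupNamespace false

open Set Filter Topology MeasureTheory intervalIntegral

namespace Summit.NavierStokesRegularity.NavierStokesRegularity.Theorems

namespace BlowupRigidityOne

open Literature.Analysis.FluidPDE Literature.Analysis.FluidPDE.TaoCascade
open Summit.NavierStokesRegularity.NavierStokesRegularity.Theorems.TaoLadderRungTwoBreakTwinRotor

/-! ## The twin-rotor table on diagonal states -/

/-- Cross feed of the twin-rotor table on diagonal states: `Σ α_{i₁i₂i,(0,0,1)} (a·d)_{i₁} (b·d)_{i₂} = 2ab` on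
the twins, `0` on the idle modes (`d = (1,1,0,0)`). [cite: Tao2016AveragedNS, §4 (4.1), Lemma 4.1 (4.8); cell vocabulary (`qform`, `twinRotorTable`)] -/
theorem qform_twinRotor_diag_feed (a b : ℝ) (i : Fin 4) :
    qform twinRotorTable (0, 0, 1) (a • twinRotorDir) (b • twinRotorDir) i =
      if i = 0 ∨ i = 1 then 2 * (a * b) else 0 := by
  unfold qform
  fin_cases i <;> simp [Fin.sum_univ_four, twinRotorTable, twinRotorDir_apply] <;> ring

/-- `(1,0,0)` back-reaction of the twin-rotor table on diagonal states: `−ab` on the twins, `0` on the idle modes.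
[cite: Tao2016AveragedNS, §4 (4.1), Lemma 4.1 (4.8); cell vocabulary (`qform`, `twinRotorTable`)] -/
theorem qform_twinRotor_diag_back₁ (a b : ℝ) (i : Fin 4) :
    qform twinRotorTable (1, 0, 0) (a • twinRotorDir) (b • twinRotorDir) i =
      if i = 0 ∨ i = 1 then -(a * b) else 0 := by
  unfold qform
  fin_cases i <;> simp [Fin.sum_univ_four, twinRotorTable, twinRotorDir_apply]

/-- `(0,1,0)` back-reaction of the twin-rotor table on diagonal states: `−ba` on the twins, `0` on the idle modes.
[cite: Tao2016AveragedNS, §4 (4.1), Lemma 4.1 (4.8); cell vocabulary (`qform`, `twinRotorTable`)] -/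
theorem qform_twinRotor_diag_back₂ (a b : ℝ) (i : Fin 4) :
    qform twinRotorTable (0, 1, 0) (b • twinRotorDir) (a • twinRotorDir) i =
      if i = 0 ∨ i = 1 then -(a * b) else 0 := by
  unfold qform
  fin_cases i <;> simp [Fin.sum_univ_four, twinRotorTable, twinRotorDir_apply] <;> ring

/-- The twin-rotor table has no intra-shell block (diagonal states). [cite: Tao2016AveragedNS, §4 (4.1); cell vocabulary (`twinRotorTable`)] -/
theorem qform_twinRotor_diag_intra (a b : ℝ) (i : Fin 4) :
    qform twinRotorTable (0, 0, 0) (a • twinRotorDir) (b • twinRotorDir) i = 0 := by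
  unfold qform
  fin_cases i <;> simp [twinRotorTable]

/-- The shell vectors of the twin family are diagonal: `x^tw_k = (X_{0,k}/2)·(1,1,0,0)`.
[cite: Tao2016AveragedNS, §4 Lemma 4.1 (the amplitudes of one shell); cell vocabulary (`shellVec`, `twinRotorDir`)] -/
theorem shellVec_twin (X : Fin 4 → ℤ → ℝ → ℝ) (k : ℤ) (t : ℝ) :
    shellVec (fun i k t => if i = 0 ∨ i = 1 then X 0 k t / 2 else 0) k t = (X 0 k t / 2) • twinRotorDir := by
  ext i
  simp only [shellVec_apply, PiLp.smul_apply, smul_eq_mul, twinRotorDir_apply]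
  split_ifs <;> simp

/-- **The cascade nonlinearity of the twin-rotor table on the twin family is half the dyadic one** on the twins
and `0` on the idle modes: `quadTerm^tw_{i,n} = ½(Λ_{n−1}X_{0,n−1}² − Λ_n X_{0,n}X_{0,n+1})` for `i ∈ {0,1}`.
[cite: Tao2016AveragedNS, §1.2 (dyadic model), §4 (4.1), Lemma 4.1 (4.8); tree `quadTerm_eq_tables`, `quadTerm_dyadicTable_zero`] -/
theorem quadTerm_twin (ε₀ : ℝ) (X : Fin 4 → ℤ → ℝ → ℝ) (i : Fin 4) (n : ℤ) (t : ℝ) :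
    quadTerm ε₀ twinRotorTable (fun i k t => if i = 0 ∨ i = 1 then X 0 k t / 2 else 0) i n t =
      if i = 0 ∨ i = 1 then quadTerm ε₀ dyadicTable X 0 n t / 2 else 0 := by
  rw [quadTerm_eq_tables, shellVec_twin, shellVec_twin, shellVec_twin, tableQ_apply, tableA_apply,
    tableB_apply, qform_twinRotor_diag_intra, qform_twinRotor_diag_feed, qform_twinRotor_diag_back₁,
    qform_twinRotor_diag_back₂, quadTerm_dyadicTable_zero]
  split_ifs <;> ring

/-! ## Global pseudo-solutions of the dyadic member embed as twin pseudo-solutions -/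

/-- `√(E/4) = √E/2`. [elementary] -/
theorem sqrt_div_four (E : ℝ) : Real.sqrt (E / 4) = Real.sqrt E / 2 := by
  rw [Real.sqrt_div' E (by norm_num : (0 : ℝ) ≤ 4), show (4 : ℝ) = 2 ^ 2 by norm_num,
    Real.sqrt_sq (by norm_num : (0 : ℝ) ≤ 2)]

/-- **THE TWIN EMBEDDING OF PSEUDO-SOLUTIONS.** For `ε₀ > −1`, if `(X, E)` obeys the conclusions (4.5)–(4.11) of
Lemma 4.1 for the dyadic member `dyadicTable` with defect constants `(K₁, K₂)` from the one-shell datum `X₀` at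
shell `n₀`, then the twin family `X^tw_{0,n} = X^tw_{1,n} = X_{0,n}/2` (idle modes `0`) with energies
`E^tw_{0,n} = E^tw_{1,n} = E_{0,n}/4` obeys them for the twin-rotor table with the SAME `(K₁, K₂)` from the diagonal
datum `(X₀ 0/2)·(1,1,0,0)` at shell `n₀`: (4.5) (amplitudes halve), (4.6)–(4.7), the motion law (4.8)
(`quadTerm_twin`: both sides halve, `√(E/4) = √E/2`), the energy inequality (4.9) and the defect bounds (4.10)
(both sides quarter), (4.11).
[cite: Tao2016AveragedNS, §1.2, §4 Lemma 4.1 (4.5)–(4.11); cell vocabulary (`CascadeODESolutionFrom`, `twinRotorTable`)] -/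
theorem cascadeODESolutionFrom_twin_of_dyadic {ε₀ K₁ K₂ : ℝ} {n₀ : ℤ} {X₀ : Fin 4 → ℝ}
    {X E : Fin 4 → ℤ → ℝ → ℝ} (hε : -1 < ε₀) (h : CascadeODESolutionFrom ε₀ dyadicTable K₁ K₂ n₀ X₀ X E) :
    CascadeODESolutionFrom ε₀ twinRotorTable K₁ K₂ n₀ (fun i => if i = 0 ∨ i = 1 then X₀ 0 / 2 else 0)
      (fun i k t => if i = 0 ∨ i = 1 then X 0 k t / 2 else 0)
      (fun i k t => if i = 0 ∨ i = 1 then E 0 k t / 4 else 0) where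
  contDiffOn_X i n := by
    by_cases hi : i = 0 ∨ i = 1
    · simp only [hi, ↓reduceIte]
      exact (h.contDiffOn_X 0 n).div_const 2
    · simp only [hi, ↓reduceIte]
      exact contDiffOn_const
  contDiffOn_E i n := by
    by_cases hi : i = 0 ∨ i = 1
    · simp only [hi, ↓reduceIte]
      exact (h.contDiffOn_E 0 n).div_const 4
    · simp only [hi, ↓reduceIte]
      exact contDiffOn_const
  nonneg_E i n t ht := by
    by_cases hi : i = 0 ∨ i = 1
    · simp only [hi, ↓reduceIte]
      exact div_nonneg (h.nonneg_E 0 n t ht) (by norm_num)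
    · simp only [hi, ↓reduceIte, le_refl]
  apriori_X T hT := by
    obtain ⟨M, hM⟩ := h.apriori_X T hT
    refine ⟨M, fun t ht i n => ?_⟩
    have h1 : (0 : ℝ) < 1 + ε₀ := by linarith
    have hw : 0 ≤ 1 + (1 + ε₀) ^ ((10 : ℝ) * n) := by positivity
    have hMn := hM t ht 0 n
    by_cases hi : i = 0 ∨ i = 1
    · simp only [hi, ↓reduceIte]
      calc (1 + (1 + ε₀) ^ ((10 : ℝ) * n)) * |X 0 n t / 2|
          ≤ (1 + (1 + ε₀) ^ ((10 : ℝ) * n)) * |X 0 n t| := by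
            refine mul_le_mul_of_nonneg_left ?_ hw
            rw [abs_div, abs_of_pos (by norm_num : (0 : ℝ) < 2)]
            linarith [abs_nonneg (X 0 n t)]
        _ ≤ M := hMn
    · simp only [hi, ↓reduceIte, abs_zero, mul_zero]
      exact le_trans (mul_nonneg hw (abs_nonneg _)) hMn
  apriori_E T hT := by
    obtain ⟨M, hM⟩ := h.apriori_E T hT
    refine ⟨M, fun t ht i n => ?_⟩
    have h1 : (0 : ℝ) < 1 + ε₀ := by linarith
    have hw : 0 ≤ 1 + (1 + ε₀) ^ ((10 : ℝ) * n) := by positivity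
    have hMn := hM t ht 0 n
    by_cases hi : i = 0 ∨ i = 1
    · simp only [hi, ↓reduceIte]
      calc (1 + (1 + ε₀) ^ ((10 : ℝ) * n)) * Real.sqrt (E 0 n t / 4)
          ≤ (1 + (1 + ε₀) ^ ((10 : ℝ) * n)) * Real.sqrt (E 0 n t) := by
            refine mul_le_mul_of_nonneg_left (Real.sqrt_le_sqrt ?_) hw
            linarith [h.nonneg_E 0 n t ht.1]
        _ ≤ M := hMn
    · simp only [hi, ↓reduceIte, Real.sqrt_zero, mul_zero]
      exact le_trans (mul_nonneg hw (Real.sqrt_nonneg _)) hMn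
  init_E i n := by
    by_cases hi : i = 0 ∨ i = 1
    · simp only [hi, ↓reduceIte]
      rw [h.init_E]
      ring
    · simp only [hi, ↓reduceIte]
      norm_num
  init_X i n := by
    by_cases hi : i = 0 ∨ i = 1
    · simp only [hi, ↓reduceIte]
      rw [h.init_X]
      split_ifs <;> simp
    · simp only [hi, ↓reduceIte]
      split_ifs <;> rfl
  motion i n t ht := by
    rw [quadTerm_twin]
    by_cases hi : i = 0 ∨ i = 1
    · simp only [hi, ↓reduceIte]
      rw [derivWithin_div_const, sqrt_div_four, ← sub_div, abs_div, abs_of_pos (by norm_num : (0 : ℝ) < 2)]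
      have := h.motion 0 n t ht
      have hK : K₁ * (1 + ε₀) ^ ((2 : ℝ) * n) * (Real.sqrt (E 0 n t) / 2) =
          K₁ * (1 + ε₀) ^ ((2 : ℝ) * n) * Real.sqrt (E 0 n t) / 2 := by ring
      rw [hK]
      exact div_le_div_of_nonneg_right this (by norm_num)
    · simp only [hi, ↓reduceIte, derivWithin_fun_const, Pi.zero_apply, sub_zero, abs_zero, Real.sqrt_zero,
        mul_zero, le_refl]
  energy i n t ht := by
    rw [quadTerm_twin]
    by_cases hi : i = 0 ∨ i = 1
    · simp only [hi, ↓reduceIte]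
      rw [derivWithin_div_const]
      have := h.energy 0 n t ht
      have hq : quadTerm ε₀ dyadicTable X 0 n t / 2 * (X 0 n t / 2) =
          quadTerm ε₀ dyadicTable X 0 n t * X 0 n t / 4 := by ring
      rw [hq]
      exact div_le_div_of_nonneg_right this (by norm_num)
    · simp only [hi, ↓reduceIte, derivWithin_fun_const, Pi.zero_apply, mul_zero, le_refl]
  defect_lower i n t ht := by
    by_cases hi : i = 0 ∨ i = 1
    · simp only [hi, ↓reduceIte]
      have := h.defect_lower 0 n t ht
      nlinarith [this]
    · simp only [hi, ↓reduceIte]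
      norm_num
  defect_upper i n t ht := by
    by_cases hi : i = 0 ∨ i = 1
    · simp only [hi, ↓reduceIte]
      rw [intervalIntegral.integral_div]
      have := h.defect_upper 0 n t ht
      have hq : 1 / 2 * (X 0 n t / 2) ^ 2 +
            K₂ * (1 + ε₀) ^ ((2 : ℝ) * n) * ((∫ s in (0 : ℝ)..t, E 0 n s) / 4) =
          (1 / 2 * X 0 n t ^ 2 + K₂ * (1 + ε₀) ^ ((2 : ℝ) * n) * ∫ s in (0 : ℝ)..t, E 0 n s) / 4 := by
        ring
      rw [hq]
      exact div_le_div_of_nonneg_right this (by norm_num)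
    · simp only [hi, ↓reduceIte, intervalIntegral.integral_zero, mul_zero, add_zero]
      norm_num
  noLow_X i n t hn ht := by
    by_cases hi : i = 0 ∨ i = 1
    · simp only [hi, ↓reduceIte, h.noLow_X 0 n t hn ht, zero_div]
    · simp only [hi, ↓reduceIte]
  noLow_E i n t hn ht := by
    by_cases hi : i = 0 ∨ i = 1
    · simp only [hi, ↓reduceIte, h.noLow_E 0 n t hn ht, zero_div]
    · simp only [hi, ↓reduceIte]

/-- **`HasGlobal` transfers from the dyadic member to the twin rotor's diagonal datum**, same `ε₀ > −1`, same
defect constants, same starting shell.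
[cite: Tao2016AveragedNS, §4 Lemma 4.1 (4.5)–(4.11); cell vocabulary (`HasGlobal`, `twinRotorTable`)] -/
theorem hasGlobal_twin_of_dyadic {ε₀ K₁ K₂ : ℝ} {n₀ : ℤ} {X₀ : Fin 4 → ℝ} (hε : -1 < ε₀)
    (h : HasGlobal ε₀ dyadicTable K₁ K₂ n₀ X₀) :
    HasGlobal ε₀ twinRotorTable K₁ K₂ n₀ (fun i => if i = 0 ∨ i = 1 then X₀ 0 / 2 else 0) := by
  obtain ⟨X, E, hXE⟩ := h
  exact ⟨_, _, cascadeODESolutionFrom_twin_of_dyadic hε hXE⟩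

/-- **A robust blow-up of the twin rotor from a diagonal datum is a robust blow-up of the dyadic member.**
`NoGlobalCascade ε₀ twinRotorTable ((X₀ 0/2)(1,1,0,0)) → NoGlobalCascade ε₀ dyadicTable X₀` (`ε₀ > −1`): for each
budget `(K₁,K₂)` and each large shell, a dyadic global pseudo-solution would embed as a twin one.
[cite: Tao2016AveragedNS, §4 Thm. 4.2 (statement shape); cell vocabulary (`NoGlobalCascade`, `twinRotorTable`)] -/
theorem noGlobalCascade_dyadic_of_twin {ε₀ : ℝ} {X₀ : Fin 4 → ℝ} (hε : -1 < ε₀)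
    (h : NoGlobalCascade ε₀ twinRotorTable (fun i => if i = 0 ∨ i = 1 then X₀ 0 / 2 else 0)) :
    NoGlobalCascade ε₀ dyadicTable X₀ := by
  intro K₁ K₂ hK₁ hK₂
  obtain ⟨N₀, hN₀⟩ := h K₁ K₂ hK₁ hK₂
  exact ⟨N₀, fun n₀ hn₀ hglob => hN₀ n₀ hn₀ (hasGlobal_twin_of_dyadic hε hglob)⟩

/-- **Every non-blow-up theorem for the dyadic member kills the twin rotor's diagonal blow-up.**
`¬ NoGlobalCascade ε₀ dyadicTable X₀ → ¬ NoGlobalCascade ε₀ twinRotorTable ((X₀ 0/2)(1,1,0,0))` (`ε₀ > −1`).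
[cite: Tao2016AveragedNS, §4 Thm. 4.2 (statement shape); cell vocabulary (`NoGlobalCascade`, `twinRotorTable`)] -/
theorem not_noGlobalCascade_twin_of_dyadic {ε₀ : ℝ} {X₀ : Fin 4 → ℝ} (hε : -1 < ε₀)
    (h : ¬ NoGlobalCascade ε₀ dyadicTable X₀) :
    ¬ NoGlobalCascade ε₀ twinRotorTable (fun i => if i = 0 ∨ i = 1 then X₀ 0 / 2 else 0) :=
  fun htw => h (noGlobalCascade_dyadic_of_twin hε htw)

/-! ## Consequences: BMR at shell ratio 2, and the dyadic break below one -/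

/-- **AT `ε₀ = 1` THE TWIN ROTOR DOES NOT BLOW UP ROBUSTLY FROM A DIAGONAL DATUM** `(a/2)(1,1,0,0)`, `a ≥ 0`:
Barbato–Morandin–Romito's Theorem 1 for the dyadic member (tree `not_noGlobalCascade_one_dyadicTable`, datum
`a·1₀`) transported along the twin embedding.  A member of `E₂(1)` with a live cross outflow and a genuinely
two-mode datum on which K2(1) and the `Target` are settled (vacuously) at shell ratio `2`.
[cite: BarbatoMorandinRomito2011, Thm. 1] [cite: Tao2016AveragedNS, §1.2 p. 9, §4 Thm. 4.2; cell vocabulary (`twinRotorTable`)] -/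
theorem not_noGlobalCascade_twin_one {a : ℝ} (ha : 0 ≤ a) :
    ¬ NoGlobalCascade 1 twinRotorTable (fun i => if i = 0 ∨ i = 1 then a / 2 else 0) := by
  have h := not_noGlobalCascade_twin_of_dyadic (X₀ := fun i => if i = (0 : Fin 4) then a else 0)
    (by norm_num : (-1 : ℝ) < 1)
    (not_noGlobalCascade_one_dyadicTable (X₀ := fun i => if i = (0 : Fin 4) then a else 0)
      (by simp [ha]) (fun i hi => if_neg hi))
  simpa using h

/-- **THE DYADIC BREAK BELOW ONE KILLS THE TWIN ROTOR'S DIAGONAL BLOW-UP AT EVERY `ε₀ ∈ (0,1)`.**  The statement of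
item ⟨24644⟩ `OrthantWake.DyadicBreakBelowOne` (spelled out as the hypothesis `hD`; certified in the tree on
`ε₀ ∈ [9/16, 1]` by `not_noGlobalCascade_dyadicTable_of_ge_nine_sixteenths`) gives: for every `ε₀ ∈ (0,1)` and
every one-shell datum `X₀`, the twin-rotor table does not blow up robustly from the diagonal datum
`(X₀ 0/2)(1,1,0,0)`.
[cite: BarbatoMorandinRomito2011, Thm. 1] [cite: Tao2016AveragedNS, §4 Thm. 4.2; cell vocabulary (`twinRotorTable`, `OrthantWake.DyadicBreakBelowOne`)] -/
theorem not_noGlobalCascade_twin_of_dyadicBreak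
    (hD : ∀ ε₀ : ℝ, 0 < ε₀ → ε₀ < 1 → ∀ X₀ : Fin 4 → ℝ, ¬ NoGlobalCascade ε₀ dyadicTable X₀)
    {ε₀ : ℝ} (h0 : 0 < ε₀) (h1 : ε₀ < 1) (X₀ : Fin 4 → ℝ) :
    ¬ NoGlobalCascade ε₀ twinRotorTable (fun i => if i = 0 ∨ i = 1 then X₀ 0 / 2 else 0) :=
  not_noGlobalCascade_twin_of_dyadic (by linarith) (hD ε₀ h0 h1 X₀)

/-- **READING FOR K2(1) / THE TARGET.**  On the twin-rotor table (a member of `E₂(R)` for every `R ≥ 1`,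
`inTableClass_twinRotorTable`) and its diagonal two-mode data, the implication of
`TaoLadderRungTwoBreak.BlowupRigidityOne` — robust blow-up ⇒ a non-trivial surviving admissible DSS wave — and the
no-blow-up statement of `Target` hold at every `ε₀ > −1` at which the dyadic member does not blow up robustly from
the corresponding one-mode datum (vacuously).  Spelled out; no route decl is named.
[cite: Tao2016AveragedNS, §4 Thm. 4.2 (statement shape), §6.4; cell vocabulary (K2(1), `twinRotorTable`)] -/
theorem blowupRigidity_twinDiag_of_dyadic {ε₀ : ℝ} (hε : -1 < ε₀) {X₀ : Fin 4 → ℝ}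
    (hdy : ¬ NoGlobalCascade ε₀ dyadicTable X₀)
    (hNG : NoGlobalCascade ε₀ twinRotorTable (fun i => if i = 0 ∨ i = 1 then X₀ 0 / 2 else 0)) :
    ∃ (q : ℕ) (π : Equiv.Perm (Fin q)) (T : ℝ) (Φ : Fin q → ℝ → Em 4),
      IsDSSWave ε₀ twinRotorTable π T Φ ∧ Surviving 1 ε₀ T ∧ ∃ r x, Φ r x ≠ 0 :=
  absurd hNG (not_noGlobalCascade_twin_of_dyadic hε hdy)

end BlowupRigidityOne

end Summit.NavierStokesRegularity.NavierStokesRegularity.Theorems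

end
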